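import Summits.QuantumFields.BalabanUV.T4Continuum.Support.PerturbationAlgebra

/-!
# T⁴ programme, spine node NE2 (U1a) — THE GRAM SHAPE: `PerturbationLaws` for `a·((B + E)ᴴ(B + E) − BᴴB)` from the norms and the
# SANDWICHED two-level pairings of an inner averaging `B` and of its transport error `E` (tier B, row B3.b of `t4/SKELETON-NE2-P1.md`)

Tenth generation of the NE2 prover lineage P1 of the cell `pub-balaban`, file 1.  The resolvent route (generations 8–9) reduced the
η-rate of the unit-lattice covariance of `(Δ_a + tP)⁻¹` to ONE typed instance `BackgroundResolventTower.PerturbationLaws D P J κ e₂` and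
catalogued the LOCAL shapes (`Σ diag(w)∇`, `Σ ∇ᴴdiag(w̄)`, `diag z`, colour versions).  The summand `a·(Q_k(U)ᴴQ_k(U) − Q_kᴴQ_k)` of
Bałaban's `Δ_a(U)` ([Balaban1985BackgroundPropagators] (3.26) p.395 «or simply Δ_a = Δ + DRD* + Q*aQ. It coincides with Δ_a in (2.19)
if U = 1») is NOT local at the fine scale (`Q_k(U)` is a `k`-fold block averaging with parallel transports); this file adds the one
NON-LOCAL shape needed for it:
 * §1 TWO LEVELS: the exact identity **`gram_two_level`** `X′ᴴY′J − JXᴴY = X′ᴴ(Y′J − Y) + (1 − JJᴴ)X′ᴴY + J(X′J − X)ᴴY` and the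
   sandwiched bound **`opNorm_sandwich_gram_le`** in terms of `‖X′‖`, `‖X′J − X‖`, the SANDWICHED pairings `‖(Y′J − Y)G‖`,
   `‖G(X′J − X)ᴴ‖`, `‖YG‖` and the free complement / injected defects `‖G′(1 − JJᴴ)‖`, `‖G′J − JG‖` of `FreeTowerLaws`;
 * §2 ALONG THE TOWER: the hypothesis SHAPE **`AveragingLaws D X J x g`** (`‖X_k‖ ≤ x`; `‖(X_{k+1}J_k − X_k)D_k⁻¹‖,
   ‖D_k⁻¹(X_{k+1}J_k − X_k)ᴴ‖ ≤ g k`), **`gramCore B E = (B + E)ᴴ(B + E) − BᴴB`** (`= BᴴE + EᴴB + EᴴE`), **`perturbationLaws_gramCore`**: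
   `FreeTowerLaws`, `‖D_k⁻¹‖ ≤ γ′`, `AveragingLaws D B J b f`, `AveragingLaws D E J ε δ` ⟹ `PerturbationLaws D (gramCore B E) J (ε(2b+ε)γ′)
   (e2gram …)`, `e2gram = 2γ′(b+ε)·δ + εγ′(2b+ε)·e₀ + 2εγ′(2b+ε)·e₁ + 2γ′ε·f` (linear; **`e2gram_le_geom`**, **`C2gram`**); `gramPert c B E`;
 * §3 THE CANONICAL INNER AVERAGING OF A FREE TOWER **`Btow A r k = √(r^k)·Atow A k`** (`‖Btow‖ ≤ 1`, **`Btow_succ_mul_J`**: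
   `Btow_{k+1}J_k = Btow_k + Btow_k·F_k`), **`averagingLaws_Btow`**: `AveragingLaws D (Btow A r) J 1 f₀` for EVERY free tower; the
   TRANSPORTED shape **`Etrans A r T k = Btow_k·(T_k − 1)`** (transport at the fine sites BEFORE averaging — the shape of
   [Balaban1985BackgroundPropagators] (3.19) p.393 «(Q′(U)λ)(y) = Σ_{x∈B(y)} L^{−d}R(U(Γ_{y,x}))λ(x)»): over an EXACTLY paired tower
   (`F = 0`, King's) and **`TransportLaws T J α′ βs`** (`‖T_k − 1‖ ≤ α′`, `‖(T_{k+1} − 1)J_k − J_k(T_k − 1)‖ ≤ βs k`),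
   **`averagingLaws_Etrans`** and **`perturbationLaws_transportedGram`**;
 * §4 ON THE KING TOWER (`calDalev`, `JpcT`; `γ′ = Cst`, `e₀ = 2dCst·L^{−k}`, `e₁ = CJ·L^{−k}`): **`perturbationLaws_gram_king`**,
   **`towerLimitRate_gram`** — the King-averaged unit-lattice covariance of `(Δ_a^{(k)} + t·c·gramCore B E k)⁻¹` converges with rate
   `L^{−k}` for ANY inner averaging / transport error with geometric sandwiched pairings (`towerLimitRate_perturbed_king`).

HONEST.  Row B3.b is REDUCED to norm data: size `ε` and sandwiched two-level consistency `δ_k` of `E_k = Q_k(U_k) − Q_k ⊗ 1` (row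
B3.a: contour transporters at two spacings = node NE3's currency via row B6, plus `O(η)` geometry) and one free law (`b`, `f_k`) of the
inner averaging (a THEOREM for the composite of any free tower, §3).  NOT done: Bałaban's line-averaged VECTOR averaging `Q(U)` of
[Balaban1985Averaging] (124) (the `Q` inside `Δ_a` carries the line factor `v_μ` of [Balaban1984PropagatorsI] (1.61); its covariant
version is not literally `Btow·(T − 1)`), the dictionary B0, local small-field regions, position-space decay.  Finite torus, linear
layer, operator norm; averagings / transports are DATA; rates / pairings / constants OURS; nothing printed is a hypothesis; NOT
infinite volume / mass gap / Clay / summit progress; spine 0/9 unchanged.  HONEST DEPENDENCY: continuum YM on T⁴ ⇐ BetaPertH ∧ nine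
spine estimates (0/9 proved); BetaPertH ⇐ (D1) ∧ (D4) ∧ CAP+tail; G-an2-4 gates asym, D1 and NE2/3/4.  ABSOLUTE RULE kept; no `sorry`.
-/

noncomputable section

open scoped BigOperators ComplexConjugate Matrix Matrix.Norms.L2Operator

namespace Summit.QuantumFields.BalabanUV.T4Continuum.GramPerturbationLaw

open Literature.MathematicalPhysics.QuantumFieldTheory.Balaban1983to89.B5Prop11Plancherel (Cst Cst_nonneg)
open Summit.QuantumFields.BalabanUV.T4Continuum
open Summit.QuantumFields.BalabanUV.T4Continuum.CovariantAveragingTower (Atow Atow_succ TowerLimitRate opNorm_Atow_sq_le)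
open Summit.QuantumFields.BalabanUV.T4Continuum.BalabanAveragedTowerUnit (idx Qlev)
open Summit.QuantumFields.BalabanUV.T4Continuum.BackgroundResolventTower
open Summit.QuantumFields.BalabanUV.T4Continuum.KingPairingPlantedLaw
open Summit.QuantumFields.BalabanUV.T4Continuum.NE2PerturbedLayer
open Summit.QuantumFields.BalabanUV.T4Continuum.PerturbationAlgebra

/-! ## §1 Two levels: the exact identity and the sandwiched bound -/

section TwoLevel

variable {α β σ : Type*} [Fintype α] [DecidableEq α] [Fintype β] [DecidableEq β] [Fintype σ] [DecidableEq σ]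

omit [DecidableEq α] [DecidableEq σ] in
/-- **THE TWO-LEVEL GRAM IDENTITY**: `X′ᴴY′J − JXᴴY = X′ᴴ(Y′J − Y) + (1 − JJᴴ)X′ᴴY + J(X′J − X)ᴴY`. [folklore] -/
theorem gram_two_level (X Y : Matrix σ α ℂ) (X' Y' : Matrix σ β ℂ) (J : Matrix β α ℂ) :
    X'ᴴ * Y' * J - J * (Xᴴ * Y)
      = X'ᴴ * (Y' * J - Y) + (1 - J * Jᴴ) * (X'ᴴ * Y) + J * (X' * J - X)ᴴ * Y := by
  rw [Matrix.conjTranspose_sub, Matrix.conjTranspose_mul]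
  simp only [Matrix.mul_sub, Matrix.sub_mul, Matrix.one_mul, Matrix.mul_assoc]
  abel

/-- **THE SANDWICHED GRAM BOUND**: `‖G′(X′ᴴY′J − JXᴴY)G‖ ≤ γ′·x·dY + e₀·x·yG + (e₁·x₂ + dX)·yG` from `‖G′‖ ≤ γ′`, `‖J‖ ≤ 1`,
`‖X′‖ ≤ x`, `‖X′J − X‖ ≤ x₂`, the sandwiched pairings `‖G(X′J − X)ᴴ‖ ≤ dX`, `‖(Y′J − Y)G‖ ≤ dY`, `‖YG‖ ≤ yG`, and the free defects
`‖G′(1 − JJᴴ)‖ ≤ e₀`, `‖G′J − JG‖ ≤ e₁`. [folklore] -/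
theorem opNorm_sandwich_gram_le {G : Matrix α α ℂ} {G' : Matrix β β ℂ} {J : Matrix β α ℂ} {X Y : Matrix σ α ℂ}
    {X' Y' : Matrix σ β ℂ} {γ' x x₂ dX dY yG e₀ e₁ : ℝ}
    (hG' : ‖G'‖ ≤ γ') (hJ : ‖J‖ ≤ 1) (hX' : ‖X'‖ ≤ x) (hx₂ : ‖X' * J - X‖ ≤ x₂)
    (hdX : ‖G * (X' * J - X)ᴴ‖ ≤ dX) (hdY : ‖(Y' * J - Y) * G‖ ≤ dY) (hyG : ‖Y * G‖ ≤ yG)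
    (he₀ : ‖G' * (1 - J * Jᴴ)‖ ≤ e₀) (he₁ : ‖G' * J - J * G‖ ≤ e₁) :
    ‖G' * (X'ᴴ * Y' * J - J * (Xᴴ * Y)) * G‖ ≤ γ' * x * dY + e₀ * x * yG + (e₁ * x₂ + dX) * yG := by
  have hx : 0 ≤ x := (norm_nonneg _).trans hX'
  have hγ : 0 ≤ γ' := (norm_nonneg _).trans hG'
  have he₀' : 0 ≤ e₀ := (norm_nonneg _).trans he₀
  have he₁' : 0 ≤ e₁ := (norm_nonneg _).trans he₁
  have hX'H : ‖X'ᴴ‖ ≤ x := by rw [Matrix.l2_opNorm_conjTranspose]; exact hX'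
  rw [gram_two_level, Matrix.mul_add, Matrix.mul_add, Matrix.add_mul, Matrix.add_mul]
  refine (norm_add_le _ _).trans (add_le_add ((norm_add_le _ _).trans (add_le_add ?_ ?_)) ?_)
  · have e : G' * (X'ᴴ * (Y' * J - Y)) * G = (G' * X'ᴴ) * ((Y' * J - Y) * G) := by simp only [Matrix.mul_assoc]
    rw [e]
    calc _ ≤ ‖G' * X'ᴴ‖ * ‖(Y' * J - Y) * G‖ := Matrix.l2_opNorm_mul _ _
      _ ≤ (γ' * x) * dY :=
          mul_le_mul ((Matrix.l2_opNorm_mul _ _).trans (mul_le_mul hG' hX'H (norm_nonneg _) hγ)) hdY (norm_nonneg _)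
            (mul_nonneg hγ hx)
  · have e : G' * ((1 - J * Jᴴ) * (X'ᴴ * Y)) * G = (G' * (1 - J * Jᴴ)) * X'ᴴ * (Y * G) := by simp only [Matrix.mul_assoc]
    rw [e]
    calc _ ≤ ‖G' * (1 - J * Jᴴ) * X'ᴴ‖ * ‖Y * G‖ := Matrix.l2_opNorm_mul _ _
      _ ≤ (e₀ * x) * yG :=
          mul_le_mul ((Matrix.l2_opNorm_mul _ _).trans (mul_le_mul he₀ hX'H (norm_nonneg _) he₀')) hyG (norm_nonneg _)
            (mul_nonneg he₀' hx)
  · have e : G' * (J * (X' * J - X)ᴴ * Y) * G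
        = ((G' * J - J * G) * (X' * J - X)ᴴ + J * (G * (X' * J - X)ᴴ)) * (Y * G) := by
      simp only [Matrix.sub_mul, Matrix.add_mul, Matrix.mul_assoc]; abel
    rw [e]
    calc _ ≤ ‖(G' * J - J * G) * (X' * J - X)ᴴ + J * (G * (X' * J - X)ᴴ)‖ * ‖Y * G‖ := Matrix.l2_opNorm_mul _ _
      _ ≤ (e₁ * x₂ + dX) * yG := by
          refine mul_le_mul ((norm_add_le _ _).trans (add_le_add ?_ ?_)) hyG (norm_nonneg _) ?_
          · refine (Matrix.l2_opNorm_mul _ _).trans (mul_le_mul he₁ ?_ (norm_nonneg _) he₁')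
            rw [Matrix.l2_opNorm_conjTranspose]; exact hx₂
          · exact (Matrix.l2_opNorm_mul _ _).trans
              ((mul_le_mul hJ hdX (norm_nonneg _) zero_le_one).trans (le_of_eq (one_mul _)))
          · exact add_nonneg (mul_nonneg he₁' ((norm_nonneg _).trans hx₂)) ((norm_nonneg _).trans hdX)

end TwoLevel

/-! ## §2 Along the tower: `AveragingLaws`, `gramCore`, and `PerturbationLaws` for the Gram shape -/

section Tower

variable {ι : ℕ → Type*} [∀ k, Fintype (ι k)] [∀ k, DecidableEq (ι k)] {σ : Type*} [Fintype σ] [DecidableEq σ]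

/-- **THE LAWS OF AN AVERAGING FAMILY** `X_k : σ ← ι k` against a free tower `D_k` and injections `J_k`: size `‖X_k‖ ≤ x` and the
SANDWICHED two-level pairings `‖(X_{k+1}J_k − X_k)D_k⁻¹‖ ≤ g k`, `‖D_k⁻¹(X_{k+1}J_k − X_k)ᴴ‖ ≤ g k`.  A hypothesis SHAPE on data;
for the composite averaging of a free tower a THEOREM (`averagingLaws_Btow`). [folklore] -/
structure AveragingLaws (D : (k : ℕ) → Matrix (ι k) (ι k) ℂ) (X : (k : ℕ) → Matrix σ (ι k) ℂ)
    (J : (k : ℕ) → Matrix (ι (k + 1)) (ι k) ℂ) (x : ℝ) (g : ℕ → ℝ) : Prop where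
  /-- size -/
  opNorm_le : ∀ k, ‖X k‖ ≤ x
  /-- sandwiched pairing, right -/
  pair_mul_inv_le : ∀ k, ‖(X (k + 1) * J k - X k) * (D k)⁻¹‖ ≤ g k
  /-- sandwiched pairing, left -/
  inv_mul_pair_le : ∀ k, ‖(D k)⁻¹ * (X (k + 1) * J k - X k)ᴴ‖ ≤ g k

/-- **THE GRAM PERTURBATION** of an inner averaging `B` by a transport error `E`: `(B + E)ᴴ(B + E) − BᴴB`. [folklore] -/
def gramCore (B E : (k : ℕ) → Matrix σ (ι k) ℂ) (k : ℕ) : Matrix (ι k) (ι k) ℂ :=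
  (B k + E k)ᴴ * (B k + E k) - (B k)ᴴ * B k

/-- the scaled Gram perturbation `c·((B + E)ᴴ(B + E) − BᴴB)` (`c = a` of `Q*aQ`). [folklore] -/
def gramPert (c : ℂ) (B E : (k : ℕ) → Matrix σ (ι k) ℂ) (k : ℕ) : Matrix (ι k) (ι k) ℂ := c • gramCore B E k

omit [∀ k, Fintype (ι k)] [∀ k, DecidableEq (ι k)] [DecidableEq σ] in
/-- `(B + E)ᴴ(B + E) − BᴴB = BᴴE + EᴴB + EᴴE`. [folklore] -/
theorem gramCore_eq (B E : (k : ℕ) → Matrix σ (ι k) ℂ) (k : ℕ) :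
    gramCore B E k = (B k)ᴴ * E k + (E k)ᴴ * B k + (E k)ᴴ * E k := by
  simp only [gramCore, Matrix.conjTranspose_add, Matrix.add_mul, Matrix.mul_add]
  abel

/-- the consistency sequence of the Gram shape: LINEAR in the four defect sequences. [folklore] -/
def e2gram (γ' b ε : ℝ) (e₀ e₁ f δ : ℕ → ℝ) (k : ℕ) : ℝ :=
  2 * γ' * (b + ε) * δ k + ε * γ' * (2 * b + ε) * e₀ k + 2 * ε * γ' * (2 * b + ε) * e₁ k + 2 * γ' * ε * f k

/-- its geometric constant. [folklore] -/
def C2gram (γ' b ε C₀ C₁ Cf Cδ : ℝ) : ℝ :=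
  2 * γ' * (b + ε) * Cδ + ε * γ' * (2 * b + ε) * C₀ + 2 * ε * γ' * (2 * b + ε) * C₁ + 2 * γ' * ε * Cf

/-- geometric inputs give `e2gram ≤ C2gram·ρ^k`. [folklore] -/
theorem e2gram_le_geom {γ' b ε ρ C₀ C₁ Cf Cδ : ℝ} {e₀ e₁ f δ : ℕ → ℝ} (hγ : 0 ≤ γ') (hb : 0 ≤ b) (hε : 0 ≤ ε)
    (h₀ : ∀ k, e₀ k ≤ C₀ * ρ ^ k) (h₁ : ∀ k, e₁ k ≤ C₁ * ρ ^ k) (hf : ∀ k, f k ≤ Cf * ρ ^ k)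
    (hδ : ∀ k, δ k ≤ Cδ * ρ ^ k) (k : ℕ) :
    e2gram γ' b ε e₀ e₁ f δ k ≤ C2gram γ' b ε C₀ C₁ Cf Cδ * ρ ^ k := by
  have a1 : 0 ≤ 2 * γ' * (b + ε) := by positivity
  have a2 : 0 ≤ ε * γ' * (2 * b + ε) := by positivity
  have a3 : 0 ≤ 2 * ε * γ' * (2 * b + ε) := by positivity
  have a4 : 0 ≤ 2 * γ' * ε := by positivity
  calc e2gram γ' b ε e₀ e₁ f δ k
      ≤ 2 * γ' * (b + ε) * (Cδ * ρ ^ k) + ε * γ' * (2 * b + ε) * (C₀ * ρ ^ k)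
          + 2 * ε * γ' * (2 * b + ε) * (C₁ * ρ ^ k) + 2 * γ' * ε * (Cf * ρ ^ k) :=
        add_le_add (add_le_add (add_le_add (mul_le_mul_of_nonneg_left (hδ k) a1) (mul_le_mul_of_nonneg_left (h₀ k) a2))
          (mul_le_mul_of_nonneg_left (h₁ k) a3)) (mul_le_mul_of_nonneg_left (hf k) a4)
    _ = C2gram γ' b ε C₀ C₁ Cf Cδ * ρ ^ k := by unfold C2gram; ring

variable {D : (k : ℕ) → Matrix (ι k) (ι k) ℂ} {A : (k : ℕ) → Matrix (ι k) (ι (k + 1)) ℂ}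
  {J : (k : ℕ) → Matrix (ι (k + 1)) (ι k) ℂ} {F : (k : ℕ) → Matrix (ι k) (ι k) ℂ} {r : ℝ} {e₀ e₁ f₀ : ℕ → ℝ}

omit [DecidableEq σ] in
/-- `‖X_{k+1}J_k − X_k‖ ≤ 2x` when `‖X‖ ≤ x`, `‖J‖ ≤ 1`. [folklore] -/
theorem opNorm_pair_le {X : (k : ℕ) → Matrix σ (ι k) ℂ} {x : ℝ} (hX : ∀ k, ‖X k‖ ≤ x) (hJ : ∀ k, ‖J k‖ ≤ 1) (k : ℕ) :
    ‖X (k + 1) * J k - X k‖ ≤ 2 * x := by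
  have hx : 0 ≤ x := (norm_nonneg _).trans (hX 0)
  calc ‖X (k + 1) * J k - X k‖ ≤ ‖X (k + 1) * J k‖ + ‖X k‖ := norm_sub_le _ _
    _ ≤ x * 1 + x := add_le_add ((Matrix.l2_opNorm_mul _ _).trans (mul_le_mul (hX _) (hJ k) (norm_nonneg _) hx)) (hX k)
    _ = 2 * x := by ring

omit [DecidableEq σ] in
/-- `‖X_kD_k⁻¹‖ ≤ x·γ′`. [folklore] -/
theorem opNorm_mul_inv_le' {X : (k : ℕ) → Matrix σ (ι k) ℂ} {x γ' : ℝ} (hX : ∀ k, ‖X k‖ ≤ x) (hγ : ∀ k, ‖(D k)⁻¹‖ ≤ γ')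
    (k : ℕ) : ‖X k * (D k)⁻¹‖ ≤ x * γ' :=
  (Matrix.l2_opNorm_mul _ _).trans (mul_le_mul (hX k) (hγ k) (norm_nonneg _) ((norm_nonneg _).trans (hX 0)))

/-- `‖D_k⁻¹X_kᴴ‖ ≤ γ′·x`. [folklore] -/
theorem opNorm_inv_mul_conjTranspose_le' {X : (k : ℕ) → Matrix σ (ι k) ℂ} {x γ' : ℝ} (hX : ∀ k, ‖X k‖ ≤ x)
    (hγ : ∀ k, ‖(D k)⁻¹‖ ≤ γ') (k : ℕ) : ‖(D k)⁻¹ * (X k)ᴴ‖ ≤ γ' * x :=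
  (Matrix.l2_opNorm_mul _ _).trans (mul_le_mul (hγ k) (by rw [Matrix.l2_opNorm_conjTranspose]; exact hX k) (norm_nonneg _)
    ((norm_nonneg _).trans (hγ 0)))

/-- **`PerturbationLaws` FOR THE GRAM SHAPE**: a free tower (`FreeTowerLaws`, `‖D_k⁻¹‖ ≤ γ′`), an inner averaging `B`
(`AveragingLaws D B J b f`) and a transport error `E` (`AveragingLaws D E J ε δ`) give
`PerturbationLaws D (gramCore B E) J (ε(2b + ε)γ′) (e2gram γ′ b ε e₀ e₁ f δ)`. [folklore] -/
theorem perturbationLaws_gramCore (hfree : FreeTowerLaws D A J F r e₀ e₁ f₀) {γ' : ℝ} (hγ : ∀ k, ‖(D k)⁻¹‖ ≤ γ')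
    {B E : (k : ℕ) → Matrix σ (ι k) ℂ} {b ε : ℝ} {f δ : ℕ → ℝ} (hB : AveragingLaws D B J b f) (hE : AveragingLaws D E J ε δ) :
    PerturbationLaws D (gramCore B E) J (ε * (2 * b + ε) * γ') (e2gram γ' b ε e₀ e₁ f δ) where
  opNorm_P_mul_inv_le := fun k => by
    have hb0 : 0 ≤ b := (norm_nonneg _).trans (hB.opNorm_le 0)
    have hε0 : 0 ≤ ε := (norm_nonneg _).trans (hE.opNorm_le 0)
    have hBH : ‖(B k)ᴴ‖ ≤ b := by rw [Matrix.l2_opNorm_conjTranspose]; exact hB.opNorm_le k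
    have hEH : ‖(E k)ᴴ‖ ≤ ε := by rw [Matrix.l2_opNorm_conjTranspose]; exact hE.opNorm_le k
    have hEG := opNorm_mul_inv_le' hE.opNorm_le hγ k
    have hBG := opNorm_mul_inv_le' hB.opNorm_le hγ k
    have hεγ : 0 ≤ ε * γ' := (norm_nonneg _).trans hEG
    rw [gramCore_eq, Matrix.add_mul, Matrix.add_mul]
    calc _ ≤ ‖(B k)ᴴ * E k * (D k)⁻¹‖ + ‖(E k)ᴴ * B k * (D k)⁻¹‖ + ‖(E k)ᴴ * E k * (D k)⁻¹‖ :=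
          (norm_add_le _ _).trans (add_le_add (norm_add_le _ _) le_rfl)
      _ ≤ b * (ε * γ') + ε * (b * γ') + ε * (ε * γ') := by
          refine add_le_add (add_le_add ?_ ?_) ?_
          · rw [Matrix.mul_assoc]
            exact (Matrix.l2_opNorm_mul _ _).trans (mul_le_mul hBH hEG (norm_nonneg _) hb0)
          · rw [Matrix.mul_assoc]
            exact (Matrix.l2_opNorm_mul _ _).trans (mul_le_mul hEH hBG (norm_nonneg _) hε0)
          · rw [Matrix.mul_assoc]
            exact (Matrix.l2_opNorm_mul _ _).trans (mul_le_mul hEH hEG (norm_nonneg _) hε0)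
      _ = ε * (2 * b + ε) * γ' := by ring
  opNorm_inv_mul_P_le := fun k => by
    have hb0 : 0 ≤ b := (norm_nonneg _).trans (hB.opNorm_le 0)
    have hε0 : 0 ≤ ε := (norm_nonneg _).trans (hE.opNorm_le 0)
    have hγ0 : 0 ≤ γ' := (norm_nonneg _).trans (hγ 0)
    have hGB := opNorm_inv_mul_conjTranspose_le' hB.opNorm_le hγ k
    have hGE := opNorm_inv_mul_conjTranspose_le' hE.opNorm_le hγ k
    rw [gramCore_eq, Matrix.mul_add, Matrix.mul_add]
    calc _ ≤ ‖(D k)⁻¹ * ((B k)ᴴ * E k)‖ + ‖(D k)⁻¹ * ((E k)ᴴ * B k)‖ + ‖(D k)⁻¹ * ((E k)ᴴ * E k)‖ :=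
          (norm_add_le _ _).trans (add_le_add (norm_add_le _ _) le_rfl)
      _ ≤ γ' * b * ε + γ' * ε * b + γ' * ε * ε := by
          refine add_le_add (add_le_add ?_ ?_) ?_
          · rw [← Matrix.mul_assoc]
            exact (Matrix.l2_opNorm_mul _ _).trans (mul_le_mul hGB (hE.opNorm_le k) (norm_nonneg _) (mul_nonneg hγ0 hb0))
          · rw [← Matrix.mul_assoc]
            exact (Matrix.l2_opNorm_mul _ _).trans (mul_le_mul hGE (hB.opNorm_le k) (norm_nonneg _) (mul_nonneg hγ0 hε0))
          · rw [← Matrix.mul_assoc]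
            exact (Matrix.l2_opNorm_mul _ _).trans (mul_le_mul hGE (hE.opNorm_le k) (norm_nonneg _) (mul_nonneg hγ0 hε0))
      _ = ε * (2 * b + ε) * γ' := by ring
  consistent_le := fun k => by
    have e : gramCore B E (k + 1) * J k - J k * gramCore B E k
        = ((B (k + 1))ᴴ * E (k + 1) * J k - J k * ((B k)ᴴ * E k))
          + ((E (k + 1))ᴴ * B (k + 1) * J k - J k * ((E k)ᴴ * B k))
          + ((E (k + 1))ᴴ * E (k + 1) * J k - J k * ((E k)ᴴ * E k)) := by
      rw [gramCore_eq, gramCore_eq]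
      simp only [Matrix.add_mul, Matrix.mul_add]
      abel
    rw [e, Matrix.mul_add, Matrix.mul_add, Matrix.add_mul, Matrix.add_mul]
    have hEG := opNorm_mul_inv_le' hE.opNorm_le hγ k
    have hBG := opNorm_mul_inv_le' hB.opNorm_le hγ k
    have h1 := opNorm_sandwich_gram_le (hγ (k + 1)) (hfree.opNorm_J_le k) (hB.opNorm_le (k + 1))
      (opNorm_pair_le hB.opNorm_le hfree.opNorm_J_le k) (hB.inv_mul_pair_le k) (hE.pair_mul_inv_le k) hEG
      (hfree.complement_le k) (hfree.injected_le k)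
    have h2 := opNorm_sandwich_gram_le (hγ (k + 1)) (hfree.opNorm_J_le k) (hE.opNorm_le (k + 1))
      (opNorm_pair_le hE.opNorm_le hfree.opNorm_J_le k) (hE.inv_mul_pair_le k) (hB.pair_mul_inv_le k) hBG
      (hfree.complement_le k) (hfree.injected_le k)
    have h3 := opNorm_sandwich_gram_le (hγ (k + 1)) (hfree.opNorm_J_le k) (hE.opNorm_le (k + 1))
      (opNorm_pair_le hE.opNorm_le hfree.opNorm_J_le k) (hE.inv_mul_pair_le k) (hE.pair_mul_inv_le k) hEG
      (hfree.complement_le k) (hfree.injected_le k)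
    refine ((norm_add_le _ _).trans (add_le_add ((norm_add_le _ _).trans (add_le_add h1 h2)) h3)).trans (le_of_eq ?_)
    unfold e2gram
    ring

/-- the scaled version: `PerturbationLaws D (gramPert c B E) J (‖c‖·ε(2b+ε)γ′) (‖c‖·e2gram)`. [folklore] -/
theorem perturbationLaws_gramPert (hfree : FreeTowerLaws D A J F r e₀ e₁ f₀) {γ' : ℝ} (hγ : ∀ k, ‖(D k)⁻¹‖ ≤ γ')
    {B E : (k : ℕ) → Matrix σ (ι k) ℂ} {b ε : ℝ} {f δ : ℕ → ℝ} (hB : AveragingLaws D B J b f) (hE : AveragingLaws D E J ε δ)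
    (c : ℂ) :
    PerturbationLaws D (gramPert c B E) J (‖c‖ * (ε * (2 * b + ε) * γ')) (fun k => ‖c‖ * e2gram γ' b ε e₀ e₁ f δ k) :=
  perturbationLaws_smul c (perturbationLaws_gramCore hfree hγ hB hE)

/-! ## §3 The canonical inner averaging of a free tower and the transported shape -/

/-- **THE NORMALISED COMPOSITE AVERAGING** `Btow A r k = √(r^k)·Atow A k : ι 0 ← ι k` (`‖Btow‖ ≤ 1`; for King's block averagings the
`k`-fold site average onto the unit lattice, isometrically normalised). [folklore] -/
def Btow (A : (k : ℕ) → Matrix (ι k) (ι (k + 1)) ℂ) (r : ℝ) (k : ℕ) : Matrix (ι 0) (ι k) ℂ :=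
  (((Real.sqrt (r ^ k) : ℝ) : ℂ)) • Atow A k

/-- `‖Btow A r k‖ ≤ 1`. [folklore] -/
theorem opNorm_Btow_le (hr : 0 < r) (hA : ∀ k, ‖A k‖ ^ 2 ≤ r⁻¹) (k : ℕ) : ‖Btow A r k‖ ≤ 1 :=
  opNorm_normalised_le (pow_pos hr k) (opNorm_Atow_sq_le A hr hA k)

/-- **THE PAIRING OF THE COMPOSITE AVERAGING**: `Btow_{k+1}·J_k = Btow_k + Btow_k·F_k` from `√r·A_kJ_k = 1 + F_k`. [folklore] -/
theorem Btow_succ_mul_J (hr : 0 < r) (hAJ : ∀ k, (((Real.sqrt r : ℝ) : ℂ)) • (A k * J k) = 1 + F k) (k : ℕ) :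
    Btow A r (k + 1) * J k = Btow A r k + Btow A r k * F k := by
  have hsq : Real.sqrt (r ^ (k + 1)) = Real.sqrt (r ^ k) * Real.sqrt r := by
    rw [pow_succ, Real.sqrt_mul (pow_nonneg hr.le k)]
  rw [Btow, Btow, Atow_succ, hsq, Complex.ofReal_mul, Matrix.smul_mul, Matrix.mul_assoc, mul_smul, ← Matrix.mul_smul, hAJ k,
    Matrix.mul_add, Matrix.mul_one, smul_add, Matrix.smul_mul]

/-- **`AveragingLaws` FOR THE COMPOSITE AVERAGING OF ANY FREE TOWER**: size `1`, sandwiched pairings the free defects `f₀`. [folklore] -/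
theorem averagingLaws_Btow (hr : 0 < r) (hfree : FreeTowerLaws D A J F r e₀ e₁ f₀) : AveragingLaws D (Btow A r) J 1 f₀ where
  opNorm_le := opNorm_Btow_le hr hfree.opNorm_A_sq_le
  pair_mul_inv_le := fun k => by
    rw [Btow_succ_mul_J hr hfree.A_mul_J k, add_sub_cancel_left, Matrix.mul_assoc]
    exact (Matrix.l2_opNorm_mul _ _).trans ((mul_le_mul (opNorm_Btow_le hr hfree.opNorm_A_sq_le k)
      (hfree.opNorm_F_mul_inv_le k) (norm_nonneg _) zero_le_one).trans (le_of_eq (one_mul _)))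
  inv_mul_pair_le := fun k => by
    rw [Btow_succ_mul_J hr hfree.A_mul_J k, add_sub_cancel_left, Matrix.conjTranspose_mul, ← Matrix.mul_assoc]
    refine (Matrix.l2_opNorm_mul _ _).trans ((mul_le_mul (hfree.opNorm_inv_mul_F_le k) ?_ (norm_nonneg _)
      ((norm_nonneg _).trans (hfree.opNorm_inv_mul_F_le k))).trans (le_of_eq (mul_one _)))
    rw [Matrix.l2_opNorm_conjTranspose]; exact opNorm_Btow_le hr hfree.opNorm_A_sq_le k

/-- **THE TRANSPORTED SHAPE** `E_k = Btow_k·(T_k − 1)`: transport `T_k` at the fine sites BEFORE the composite averaging (the shape of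
the covariant site averaging [Balaban1985BackgroundPropagators] (3.19) p.393 minus the free one). [folklore] -/
def Etrans (A : (k : ℕ) → Matrix (ι k) (ι (k + 1)) ℂ) (r : ℝ) (T : (k : ℕ) → Matrix (ι k) (ι k) ℂ) (k : ℕ) :
    Matrix (ι 0) (ι k) ℂ :=
  Btow A r k * (T k - 1)

/-- **THE LAWS OF A TRANSPORT FAMILY** `T_k` (hypothesis SHAPE on data): `‖T_k − 1‖ ≤ α′` (small field) and the two-level intertwining
defect `‖(T_{k+1} − 1)J_k − J_k(T_k − 1)‖ ≤ βs k` (transporters at adjacent spacings agree at the block parent up to `βs k`). [folklore] -/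
structure TransportLaws (T : (k : ℕ) → Matrix (ι k) (ι k) ℂ) (J : (k : ℕ) → Matrix (ι (k + 1)) (ι k) ℂ) (α' : ℝ) (βs : ℕ → ℝ) :
    Prop where
  /-- small field -/
  sub_one_le : ∀ k, ‖T k - 1‖ ≤ α'
  /-- two-level intertwining -/
  intertwine_le : ∀ k, ‖(T (k + 1) - 1) * J k - J k * (T k - 1)‖ ≤ βs k

/-- for an EXACTLY paired tower (`F = 0`): `E_{k+1}J_k − E_k = Btow_{k+1}·((T_{k+1} − 1)J_k − J_k(T_k − 1))`. [folklore] -/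
theorem Etrans_succ_mul_J_sub (hr : 0 < r) (hAJ : ∀ k, (((Real.sqrt r : ℝ) : ℂ)) • (A k * J k) = 1 + F k) (hF : ∀ k, F k = 0)
    (T : (k : ℕ) → Matrix (ι k) (ι k) ℂ) (k : ℕ) :
    Etrans A r T (k + 1) * J k - Etrans A r T k = Btow A r (k + 1) * ((T (k + 1) - 1) * J k - J k * (T k - 1)) := by
  have hB : Btow A r (k + 1) * J k = Btow A r k := by rw [Btow_succ_mul_J hr hAJ k, hF k, Matrix.mul_zero, add_zero]
  rw [Etrans, Etrans, ← hB, Matrix.mul_sub (Btow A r (k + 1)) ((T (k + 1) - 1) * J k) (J k * (T k - 1))]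
  simp only [Matrix.mul_assoc]

/-- **`AveragingLaws` FOR THE TRANSPORTED SHAPE** over an exactly paired tower: size `α′`, sandwiched pairings `γ′·βs k`. [folklore] -/
theorem averagingLaws_Etrans (hr : 0 < r) (hfree : FreeTowerLaws D A J F r e₀ e₁ f₀) (hF : ∀ k, F k = 0) {γ' : ℝ}
    (hγ : ∀ k, ‖(D k)⁻¹‖ ≤ γ') {T : (k : ℕ) → Matrix (ι k) (ι k) ℂ} {α' : ℝ} {βs : ℕ → ℝ} (hT : TransportLaws T J α' βs) :
    AveragingLaws D (Etrans A r T) J α' (fun k => γ' * βs k) where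
  opNorm_le := fun k => (Matrix.l2_opNorm_mul _ _).trans ((mul_le_mul (opNorm_Btow_le hr hfree.opNorm_A_sq_le k)
    (hT.sub_one_le k) (norm_nonneg _) zero_le_one).trans (le_of_eq (one_mul _)))
  pair_mul_inv_le := fun k => by
    have hβ : 0 ≤ βs k := (norm_nonneg _).trans (hT.intertwine_le k)
    rw [Etrans_succ_mul_J_sub hr hfree.A_mul_J hF T k]
    calc _ ≤ ‖Btow A r (k + 1) * ((T (k + 1) - 1) * J k - J k * (T k - 1))‖ * ‖(D k)⁻¹‖ := Matrix.l2_opNorm_mul _ _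
      _ ≤ (1 * βs k) * γ' := mul_le_mul ((Matrix.l2_opNorm_mul _ _).trans (mul_le_mul
          (opNorm_Btow_le hr hfree.opNorm_A_sq_le _) (hT.intertwine_le k) (norm_nonneg _) zero_le_one)) (hγ k) (norm_nonneg _)
          (by rw [one_mul]; exact hβ)
      _ = γ' * βs k := by ring
  inv_mul_pair_le := fun k => by
    have hγ0 : 0 ≤ γ' := (norm_nonneg _).trans (hγ 0)
    rw [Etrans_succ_mul_J_sub hr hfree.A_mul_J hF T k, Matrix.conjTranspose_mul, ← Matrix.mul_assoc]
    calc _ ≤ ‖(D k)⁻¹ * ((T (k + 1) - 1) * J k - J k * (T k - 1))ᴴ‖ * ‖(Btow A r (k + 1))ᴴ‖ := Matrix.l2_opNorm_mul _ _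
      _ ≤ (γ' * βs k) * 1 := by
          refine mul_le_mul ((Matrix.l2_opNorm_mul _ _).trans (mul_le_mul (hγ k) ?_ (norm_nonneg _) hγ0)) ?_ (norm_nonneg _)
            (mul_nonneg hγ0 ((norm_nonneg _).trans (hT.intertwine_le k)))
          · rw [Matrix.l2_opNorm_conjTranspose]; exact hT.intertwine_le k
          · rw [Matrix.l2_opNorm_conjTranspose]; exact opNorm_Btow_le hr hfree.opNorm_A_sq_le _
      _ = γ' * βs k := mul_one _

/-- **THE TRANSPORTED GRAM LAW** over an exactly paired free tower. [folklore] -/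
theorem perturbationLaws_transportedGram (hr : 0 < r) (hfree : FreeTowerLaws D A J F r e₀ e₁ f₀) (hF : ∀ k, F k = 0) {γ' : ℝ}
    (hγ : ∀ k, ‖(D k)⁻¹‖ ≤ γ') {T : (k : ℕ) → Matrix (ι k) (ι k) ℂ} {α' : ℝ} {βs : ℕ → ℝ} (hT : TransportLaws T J α' βs) :
    PerturbationLaws D (gramCore (Btow A r) (Etrans A r T)) J (α' * (2 * 1 + α') * γ') (e2gram γ' 1 α' e₀ e₁ f₀ (fun k => γ' * βs k)) :=
  perturbationLaws_gramCore hfree hγ (averagingLaws_Btow hr hfree) (averagingLaws_Etrans hr hfree hF hγ hT)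

end Tower

/-! ## §4 On the King tower: geometric consistency, the η-rate -/

section King

variable {d : ℕ} (L : ℕ) [NeZero L] (M : Fin d → ℕ) [hM : ∀ μ, NeZero (M μ)] (a : ℝ) (ha : 0 < a)
variable {σ : Type*} [Fintype σ] [DecidableEq σ]

/-- **THE GRAM LAW ON THE KING TOWER** (`Δ_a^{(k)}`, `J_k = L^{d/2}Q_Lᴴ`; `γ′ = Cst`, `e₀ = 2dCst·L^{−k}`, `e₁ = CJ·L^{−k}`): GEOMETRIC sandwiched
pairings ⟹ `PerturbationLaws (calDalev) (gramPert c B E) (JpcT) (‖c‖·ε(2b+ε)Cst) ((‖c‖·C2gram Cst b ε (2dCst) CJ Cf Cδ)·L^{−k})`.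
[cite: Balaban1984PropagatorsI, Prop. 1.1 (1.89) p.33; King1986, (2.10) p.653, p.664] [folklore] -/
theorem perturbationLaws_gram_king {B E : (k : ℕ) → Matrix σ (idx L M k) ℂ} {b ε Cf Cδ : ℝ} (hb : 0 ≤ b) (hε : 0 ≤ ε)
    (hB : AveragingLaws (calDalev L M a ha) B (JpcT L M) b (fun k => Cf * ((L : ℝ)⁻¹) ^ k))
    (hE : AveragingLaws (calDalev L M a ha) E (JpcT L M) ε (fun k => Cδ * ((L : ℝ)⁻¹) ^ k)) (c : ℂ) :
    PerturbationLaws (calDalev L M a ha) (gramPert c B E) (JpcT L M) (‖c‖ * (ε * (2 * b + ε) * Cst d a))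
      (fun k => (‖c‖ * C2gram (Cst d a) b ε (2 * d * Cst d a) (CJ d a) Cf Cδ) * ((L : ℝ)⁻¹) ^ k) := by
  refine perturbationLaws_mono (perturbationLaws_gramPert (freeTowerLaws_king L M a ha) (opNorm_inv_calDalev_le L M a ha) hB hE c)
    le_rfl fun k => ?_
  refine (mul_le_mul_of_nonneg_left (e2gram_le_geom (ρ := (L : ℝ)⁻¹) (Cst_nonneg d a) hb hε (fun k => le_rfl) (fun k => le_rfl)
    (fun k => le_rfl) (fun k => le_rfl) k) (norm_nonneg c)).trans (le_of_eq ?_)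
  ring

/-- **η-RATE FOR THE GRAM SHAPE** (`L ≥ 2`, `‖t‖·‖c‖ε(2b+ε)Cst < 1`): the King-averaged unit-lattice covariances of
`(Δ_a^{(k)} + t·c·((B_k + E_k)ᴴ(B_k + E_k) − B_kᴴB_k))⁻¹` CONVERGE, `‖c_k(t) − c_∞(t)‖ ≤ Cpert(t)·L^{−k}/(1 − L^{−1})`, all orders in `t`;
statement / pairing / constants OURS. [cite: King1986, Lemma 4.5 (4.32)/(4.38) p.674 (scalar template); Balaban1985BackgroundPropagators,
(3.26) p.395 (where `Q*(U)aQ(U)` enters)] [folklore] -/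
theorem towerLimitRate_gram (hL : 2 ≤ L) {B E : (k : ℕ) → Matrix σ (idx L M k) ℂ} {b ε Cf Cδ : ℝ} (hb : 0 ≤ b) (hε : 0 ≤ ε)
    (hB : AveragingLaws (calDalev L M a ha) B (JpcT L M) b (fun k => Cf * ((L : ℝ)⁻¹) ^ k))
    (hE : AveragingLaws (calDalev L M a ha) E (JpcT L M) ε (fun k => Cδ * ((L : ℝ)⁻¹) ^ k)) (c : ℂ) {t : ℂ}
    (ht : ‖t‖ * (‖c‖ * (ε * (2 * b + ε) * Cst d a)) < 1) :
    TowerLimitRate (Qlev L M) ((L : ℝ) ^ d) (fun k => (calDalev L M a ha k + t • gramPert c B E k)⁻¹)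
      (Cpert (‖c‖ * (ε * (2 * b + ε) * Cst d a)) (2 * d * Cst d a) (CJ d a)
        (‖c‖ * C2gram (Cst d a) b ε (2 * d * Cst d a) (CJ d a) Cf Cδ) 0 t) ((L : ℝ)⁻¹) :=
  towerLimitRate_perturbed_king L M a ha hL (perturbationLaws_gram_king L M a ha hb hε hB hE c) ht

end King

end Summit.QuantumFields.BalabanUV.T4Continuum.GramPerturbationLaw

end
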